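import Summits.BirchSwinnertonDyer.Uniform.U2.TwoTrivialIffOddTrace
import Literature.NumberTheory.EllipticCurves.Zhai2016.NonvanishingQuadraticTwists
import Literature.NumberTheory.EllipticCurves.OrdinaryPrimesProofs
import HarnessLib

/-!
# Track U2 (cell `bsd-uniform`, seat u2-p1): Zhai's hypothesis «`q` inert in the cubic `2`-division
# field `F`» IS the cell's class condition «`a_q(E)` odd» — INGREDIENTS F9, the open half, PROVED

HONEST FRAMING (cell `bsd-uniform`, HOME run/shared/lean/pub/bsd-uniform/, verbatim in every file of
the seat): elementary algebraic number theory of the cubic field of the `2`-division polynomial; no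
claim about BSD, nothing booked, no census number moves, no per-curve certificate is counted as a
uniform theorem. PURPOSE: Zhai 2016 Thms 1.1 / 1.2 (tree named facts
`Zhai2016.thm11_ordTwo_LAlg_twist_eq_zero'` / `thm12_ordTwo_LAlg_twist_eq_one'`) are printed for
twisting primes `q` «inert in the field `F` obtained by adjoining one root of the `2`-division
polynomial» (`Zhai2016.IsInertIn F q`, binder `hin` of every Zhai consumer of the tree:
`P2.bsdp_two_twist_iff_of_zhai11'`, `U2.routeA_bsdp_two_twist_iff_of_zhai11'`,
`U2.bsdp_two_twist_of_zhai11'_boxerDiao`, …), whereas the cell's class condition (T4-PROOF §1, the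
set `𝒮′`; HOME/u2/INGREDIENTS.md §7 F9) is «`q ∤ 2N` and `a_q(E)` odd». `TwoTrivialIffOddTrace.lean`
proved `a_q` odd ⟺ `#Ẽ(𝔽_q)` odd ⟺ Boxer–Diao's «2-trivial»; THIS FILE proves the remaining
implication INGREDIENTS F9 left open: **`a_q` odd (at a good odd prime `q`) ⟹ `q` inert in `F`**, and
that a cubic `2`-division number field EXISTS as soon as `E(ℚ)[2] = 0`. With it, Zhai's two binders
`F` / `hin` are discharged from the `a_q`-odd class condition (consumed by `ZhaiUnitOfBase.lean`).

THE PROOF. Let `W` be a global minimal model, `4X³ + b₂X² + 2b₄X + b₆` its `2`-division cubic,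
`θ ∈ F` a root, `[F : ℚ] = 3`. Then `η = 4θ` is a root of the MONIC integral cubic
`g = Y³ + b₂Y² + 8b₄Y + 16b₆` (`= 16·cubic(Y/4)`), so `η ∈ 𝓞_F`. At an odd good prime `q` with `a_q`
odd, `#Ẽ(𝔽_q) = q + 1 − a_q` is odd, so `Ẽ(𝔽_q)` has no point of order `2`, so the reduced cubic has
no root in `𝔽_q` (a root `x₀` carries the `2`-torsion point `(x₀, −(a₁x₀ + a₃)/2)`, Silverman AEC
III.2.3 / Ex. 3.7), so `ḡ = g mod q` (roots `= 4 ×` those) is an IRREDUCIBLE cubic over `𝔽_q`. Hence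
`𝔽_q[Y]/(ḡ) ≅ 𝔽_{q³}` embeds in `𝓞_F/q𝓞_F` (`Y ↦ η̄`; a ring map out of a field is injective), and
both have `𝔽_q`-dimension `3 = [F : ℚ]` (Mathlib `Ideal.finrank_quotient_map`), so `𝓞_F/q𝓞_F` is a
field and `q𝓞_F` is a prime ideal: `q` is inert in `F` (Marcus, *Number Fields*, Ch. 3 Thm. 27 for
the Dedekind–Kummer direction one usually quotes; the dimension count avoids the conductor
hypothesis `q ∤ [𝓞_F : ℤ[η]]`).

## Contents (theorems only; no `def`, no named fact)
* `isPrime_span_of_irreducible_map` — ALGEBRA: `[F : ℚ] = deg g`, `g ∈ ℤ[X]` monic with an integral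
  root `η ∈ 𝓞_F` and `g mod q` irreducible ⟹ `q𝓞_F` prime.
* `exists_ne_zero_two_nsmul_eq_zero_of_cubic_root`, `two_dvd_natCard_point_of_cubic_root` — over a
  field with `2 ≠ 0`, a root of the `2`-division cubic of an elliptic curve is the abscissa of a
  point of order `2`; so `2 ∣ #E(F)` when the point group is finite.
* `irreducible_twoDivisionMonic_map_of_odd_frobeniusTrace` — `ḡ` is irreducible over `𝔽_q` at an odd
  good prime with `a_q` odd.
* `exists_integral_root_twoDivisionMonic` — `η = 4θ ∈ 𝓞_F` is a root of `g`.
* **`isInertIn_of_odd_frobeniusTrace`** — THE DICTIONARY: `IsTwoDivisionField W F`, `q` odd,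
  `q ∤ Δ_min(W)`, `a_q(W)` odd ⟹ `Zhai2016.IsInertIn F q`.
* `forall_isInertIn_of_oddTrace` — Zhai's binder `hin` on `M.natAbs.primeFactors` from the cell's
  class condition `hS`.
* **`exists_isTwoDivisionField`** — `E(ℚ)[2] = 0` ⟹ the `2`-division cubic is irreducible over `ℚ`
  and `F = ℚ[X]/(cubic)` is a cubic `2`-division number field (`Zhai2016.IsTwoDivisionField W F`).

References: S. Zhai, Asian J. Math. 20 (2016) §1 (the field `F`, "inert in `F`") [Zhai2016];
J. H. Silverman, *AEC* 2nd ed. (2009) III.2.3, Ex. 3.7, VII.2–VII.3, V.2 [SilvermanAEC2009];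
D. A. Marcus, *Number Fields* (2018) Ch. 3 Thm. 27 [Marcus2018]; HOME/u2/INGREDIENTS.md §7 F9.
-/

noncomputable section

open scoped Classical Polynomial NumberField

open Polynomial WeierstrassCurve NumberField Module Literature.NumberTheory.EllipticCurves
  Literature.NumberTheory.EllipticCurves.Zhai2016

namespace Summit.BirchSwinnertonDyer.Uniform.U2

/-! ## §1 Algebra: `q𝓞_F` is prime when a degree-`[F:ℚ]` integral generator polynomial stays irreducible mod `q` -/

/-- **`q𝓞_F` is prime if `𝓞_F` contains a root of a monic `g ∈ ℤ[X]` of degree `[F : ℚ]` whose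
reduction mod `q` is irreducible.** `𝔽_q[X]/(ḡ)` is a field; `X ↦ η̄` maps it (injectively, being a
field) into `𝓞_F/q𝓞_F`, whose `𝔽_q`-dimension is `[F : ℚ] = deg ḡ` (`Ideal.finrank_quotient_map`);
so the map is onto, `𝓞_F/q𝓞_F` is a field, `q𝓞_F` is maximal. (No hypothesis on the index
`[𝓞_F : ℤ[η]]`.) [cite: Marcus2018, Ch. 3 Thm. 27 (decomposition of primes via a generator; the inert case)] -/
theorem isPrime_span_of_irreducible_map {F : Type*} [Field F] [NumberField F] {q : ℕ}
    (hq : q.Prime) {g : ℤ[X]} (hg : g.Monic) (hdeg : g.natDegree = Module.finrank ℚ F)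
    (hirr : Irreducible (g.map (Int.castRingHom (ZMod q))))
    (η : 𝓞 F) (hη : aeval η g = 0) :
    (Ideal.span {((q : ℤ) : 𝓞 F)}).IsPrime := by
  -- the prime `p = (q) ⊂ ℤ`, residue field `R₀ = ℤ/(q)`, and `A = 𝓞_F / q𝓞_F = 𝓞_F / p𝓞_F`
  set p : Ideal ℤ := Ideal.span {(q : ℤ)} with hp
  haveI hpmax : p.IsMaximal :=
    PrincipalIdealRing.isMaximal_of_irreducible (Nat.prime_iff_prime_int.mp hq).irreducible
  set I : Ideal (𝓞 F) := Ideal.map (algebraMap ℤ (𝓞 F)) p with hI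
  have hIspan : I = Ideal.span {((q : ℤ) : 𝓞 F)} := by
    rw [hI, hp, Ideal.map_span, Set.image_singleton, eq_intCast]
  rw [← hIspan]
  letI : Field (ℤ ⧸ p) := Ideal.Quotient.field p
  -- `dim_{R₀} A = [F : ℚ]`
  have hdimA : finrank (ℤ ⧸ p) (𝓞 F ⧸ I) = finrank ℚ F := Ideal.finrank_quotient_map p ℚ F
  have hnpos : 0 < finrank ℚ F := finrank_pos
  haveI : Module.Finite (ℤ ⧸ p) (𝓞 F ⧸ I) := Module.finite_of_finrank_pos (by omega)
  haveI : Nontrivial (𝓞 F ⧸ I) :=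
    Module.nontrivial_of_finrank_pos (R := ℤ ⧸ p) (by omega)
  -- the reduced polynomial over `R₀` is irreducible (transport from `ZMod q` along `ℤ/(q) ≃ ZMod q`)
  set g₀ : (ℤ ⧸ p)[X] := g.map (algebraMap ℤ (ℤ ⧸ p)) with hg₀
  have hirr₀ : Irreducible g₀ := by
    let e : ℤ ⧸ p ≃+* ZMod q := Int.quotientSpanNatEquivZMod q
    have hmap : (Polynomial.mapEquiv e) g₀ = g.map (Int.castRingHom (ZMod q)) := by
      change g₀.map (e : ℤ ⧸ p →+* ZMod q) = _
      rw [hg₀, Polynomial.map_map, RingHom.ext_int ((e : ℤ ⧸ p →+* ZMod q).comp _)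
        (Int.castRingHom (ZMod q))]
    rw [← hmap] at hirr
    exact (MulEquiv.irreducible_iff (Polynomial.mapEquiv e)).mp hirr
  haveI : Fact (Irreducible g₀) := ⟨hirr₀⟩
  have hg₀monic : g₀.Monic := hg.map _
  have hg₀deg : g₀.natDegree = finrank ℚ F := by rw [hg₀, hg.natDegree_map, hdeg]
  have hg₀ne : g₀ ≠ 0 := hg₀monic.ne_zero
  -- `η̄ ∈ A` is a root of `g₀`
  set ηb : 𝓞 F ⧸ I := Ideal.Quotient.mk I η with hηb
  have hroot : g₀.eval₂ (algebraMap (ℤ ⧸ p) (𝓞 F ⧸ I)) ηb = 0 := by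
    rw [hg₀, eval₂_map]
    have h1 : (algebraMap (ℤ ⧸ p) (𝓞 F ⧸ I)).comp (algebraMap ℤ (ℤ ⧸ p)) =
        (Ideal.Quotient.mk I).comp (algebraMap ℤ (𝓞 F)) := RingHom.ext_int _ _
    rw [h1, hηb, ← Polynomial.hom_eval₂, ← aeval_def, hη, map_zero]
  -- the lift `R₀[X]/(g₀) → A`, an `R₀`-algebra map out of a field: injective
  set φ : AdjoinRoot g₀ →+* 𝓞 F ⧸ I := AdjoinRoot.lift (algebraMap (ℤ ⧸ p) (𝓞 F ⧸ I)) ηb hroot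
    with hφ
  let φa : AdjoinRoot g₀ →ₐ[ℤ ⧸ p] (𝓞 F ⧸ I) :=
    { φ with
      commutes' := fun r => by
        change φ (algebraMap (ℤ ⧸ p) (AdjoinRoot g₀) r) = _
        rw [AdjoinRoot.algebraMap_eq, hφ, AdjoinRoot.lift_of] }
  have hinj : Function.Injective φa := φ.injective
  -- equal finite dimensions ⇒ bijective
  have hdimR : finrank (ℤ ⧸ p) (AdjoinRoot g₀) = finrank ℚ F := by
    rw [(AdjoinRoot.powerBasis hg₀ne).finrank, AdjoinRoot.powerBasis_dim, hg₀deg]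
  haveI : Module.Finite (ℤ ⧸ p) (AdjoinRoot g₀) := Module.finite_of_finrank_pos (by omega)
  have hsurj : Function.Surjective φa :=
    (LinearMap.injective_iff_surjective_of_finrank_eq_finrank (f := φa.toLinearMap)
      (hdimR.trans hdimA.symm)).mp hinj
  -- so `A` is a field and `I` is maximal, hence prime
  have hfield : IsField (𝓞 F ⧸ I) :=
    MulEquiv.isField (Field.toIsField (AdjoinRoot g₀))
      (RingEquiv.ofBijective φa ⟨hinj, hsurj⟩).symm.toMulEquiv
  exact (Ideal.Quotient.maximal_of_isField I hfield).isPrime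

/-! ## §2 Over a field with `2 ≠ 0`: a root of the `2`-division cubic gives a point of order `2` -/

/-- **A root of the `2`-division cubic is the abscissa of a point of order `2`.** Over a field `F`
with `2 ≠ 0`, if `4x₀³ + b₂x₀² + 2b₄x₀ + b₆ = 0` for an elliptic `E / F`, then
`P = (x₀, −(a₁x₀ + a₃)/2) ∈ E(F)` satisfies `−P = P ≠ O`, i.e. `2P = O` (Silverman AEC III.2.3 /
Ex. 3.7; tree `equation_of_twoTorsionPolynomial_root`, `negY_twoTorsion`).
[cite: SilvermanAEC2009, III.2.3 and Exercise 3.7] -/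
theorem exists_ne_zero_two_nsmul_eq_zero_of_cubic_root {F : Type*} [Field F] [DecidableEq F]
    (E : WeierstrassCurve F) [E.IsElliptic] (h2 : (2 : F) ≠ 0) {x₀ : F}
    (hx : 4 * x₀ ^ 3 + E.b₂ * x₀ ^ 2 + 2 * E.b₄ * x₀ + E.b₆ = 0) :
    ∃ P : E.toAffine.Point, P ≠ 0 ∧ (2 : ℕ) • P = 0 := by
  have heq := E.equation_of_twoTorsionPolynomial_root h2 hx
  set P : E.toAffine.Point :=
    .some x₀ _ ((Affine.equation_iff_nonsingular).mp heq) with hP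
  have hneg : -P = P := by
    rw [hP, Affine.Point.neg_some]
    congr 1
    exact E.negY_twoTorsion h2 x₀
  refine ⟨P, Affine.Point.some_ne_zero _, ?_⟩
  rw [two_nsmul, ← neg_eq_iff_add_eq_zero, hneg]

/-- **A root of the `2`-division cubic forces `2 ∣ #E(F)`** (finite point group): the point of order
`2` of `exists_ne_zero_two_nsmul_eq_zero_of_cubic_root` and Lagrange / Cauchy
(`forall_two_nsmul_eq_zero_iff_odd_card`). [cite: SilvermanAEC2009, III.2.3 and Exercise 3.7] -/
theorem two_dvd_natCard_point_of_cubic_root {F : Type*} [Field F] [DecidableEq F]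
    (E : WeierstrassCurve F) [E.IsElliptic] [Finite E.toAffine.Point] (h2 : (2 : F) ≠ 0) {x₀ : F}
    (hx : 4 * x₀ ^ 3 + E.b₂ * x₀ ^ 2 + 2 * E.b₄ * x₀ + E.b₆ = 0) :
    2 ∣ Nat.card E.toAffine.Point := by
  obtain ⟨P, hP0, h2P⟩ := exists_ne_zero_two_nsmul_eq_zero_of_cubic_root E h2 hx
  by_contra hodd
  have hodd' : Odd (Nat.card E.toAffine.Point) := Nat.odd_iff.mpr (Nat.two_dvd_ne_zero.mp hodd)
  exact hP0 (forall_two_nsmul_eq_zero_iff_odd_card.mpr hodd' P h2P)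

/-! ## §3 The monic integral cubic `g = Y³ + b₂Y² + 8b₄Y + 16b₆` (`= 16 · cubic(Y/4)`) -/

/-- **At an odd good prime `q` with `a_q` odd, `g mod q` is irreducible over `𝔽_q`.** With
`M = integralModelInt W` and `g = Y³ + b₂Y² + 8b₄Y + 16b₆ ∈ ℤ[Y]`: a root `y₀ ∈ 𝔽_q` of `ḡ` gives
the root `x₀ = y₀/4` of the reduced `2`-division cubic, hence (§2) `2 ∣ #Ẽ(𝔽_q) = q + 1 − a_q`,
contradicting `a_q` odd (`odd_frobeniusTrace_iff_odd_reductionPointCount`); a cubic over a field with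
no root is irreducible. Good reduction (`q ∤ Δ_min`) makes `Ẽ / 𝔽_q` elliptic.
[cite: SilvermanAEC2009, III.2.3, Exercise 3.7 and V.2] -/
theorem irreducible_twoDivisionMonic_map_of_odd_frobeniusTrace (W : WeierstrassCurve ℚ)
    [W.IsGloballyMinimal] {q : ℕ} (hq : q.Prime) (hq2 : q ≠ 2)
    (hgood : ¬ (q : ℤ) ∣ minimalDiscriminantInt W) (hodd : Odd (W.frobeniusTrace q)) :
    Irreducible ((Cubic.toPoly ⟨1, (integralModelInt W).b₂, 8 * (integralModelInt W).b₄,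
      16 * (integralModelInt W).b₆⟩).map (Int.castRingHom (ZMod q))) := by
  haveI : Fact q.Prime := ⟨hq⟩
  haveI : NeZero q := ⟨hq.ne_zero⟩
  set M : WeierstrassCurve ℤ := integralModelInt W with hM
  -- the reduced curve `Ẽ / 𝔽_q`, elliptic by good reduction, with `#Ẽ(𝔽_q)` odd
  set E : WeierstrassCurve (ZMod q) := M.map (Int.castRingHom (ZMod q)) with hE
  haveI : E.IsElliptic := by
    refine ⟨isUnit_iff_ne_zero.mpr ?_⟩
    rw [hE, map_Δ, eq_intCast, Ne, ZMod.intCast_zmod_eq_zero_iff_dvd]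
    exact hgood
  have hcard : Odd (Nat.card E.toAffine.Point) :=
    (odd_frobeniusTrace_iff_odd_reductionPointCount W hq hq2).mp hodd
  have h2 : (2 : ZMod q) ≠ 0 := by
    intro h
    have h' : ((2 : ℕ) : ZMod q) = 0 := by exact_mod_cast h
    rw [ZMod.natCast_eq_zero_iff] at h'
    exact hq2 ((Nat.prime_dvd_prime_iff_eq hq Nat.prime_two).mp h')
  have h4 : (4 : ZMod q) ≠ 0 := by
    have : (4 : ZMod q) = 2 * 2 := by norm_num
    rw [this]; exact mul_ne_zero h2 h2
  -- the reduced polynomial, monic of degree 3: irreducible iff no root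
  rw [← Cubic.map_toPoly]
  set Pq : Cubic (ZMod q) := Cubic.map (Int.castRingHom (ZMod q)) ⟨1, M.b₂, 8 * M.b₄, 16 * M.b₆⟩
    with hPq
  have hPqa : Pq.a = 1 := by simp [hPq, Cubic.map]
  have hdeg : Pq.toPoly.natDegree = 3 := Cubic.natDegree_of_a_ne_zero (by rw [hPqa]; exact one_ne_zero)
  have hne : Pq.toPoly ≠ 0 := Cubic.ne_zero_of_a_ne_zero (by rw [hPqa]; exact one_ne_zero)
  refine Polynomial.irreducible_of_degree_le_three_of_not_isRoot (by rw [hdeg]; decide) fun y hy => ?_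
  -- a root `y` of `ḡ` gives the root `x₀ = y / 4` of the reduced `2`-division cubic
  have hy' : y ∈ Pq.roots := (mem_roots hne).mpr hy
  rw [Cubic.mem_roots_iff hne] at hy'
  simp only [hPq, Cubic.map, eq_intCast, Int.cast_mul, Int.cast_ofNat, Int.cast_one, one_mul] at hy'
  set x₀ : ZMod q := y / 4 with hx₀
  have hyx : y = 4 * x₀ := by rw [hx₀]; field_simp
  have hx : 4 * x₀ ^ 3 + E.b₂ * x₀ ^ 2 + 2 * E.b₄ * x₀ + E.b₆ = 0 := by
    have h16 : (16 : ZMod q) ≠ 0 := by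
      have : (16 : ZMod q) = 4 * 4 := by norm_num
      rw [this]; exact mul_ne_zero h4 h4
    have key : (16 : ZMod q) * (4 * x₀ ^ 3 + E.b₂ * x₀ ^ 2 + 2 * E.b₄ * x₀ + E.b₆) = 0 := by
      rw [hE, map_b₂, map_b₄, map_b₆, eq_intCast, eq_intCast, eq_intCast]
      rw [hyx] at hy'
      linear_combination hy'
    exact (mul_eq_zero.mp key).resolve_left h16
  -- so `2 ∣ #Ẽ(𝔽_q)`, contradicting oddness
  have h2dvd := two_dvd_natCard_point_of_cubic_root E h2 hx
  exact (Nat.not_even_iff_odd.mpr hcard) (even_iff_two_dvd.mpr h2dvd)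

/-- **`η = 4θ` is an integral root of `g`.** If `θ ∈ F` is a root of the `2`-division cubic
`4X³ + b₂X² + 2b₄X + b₆` of the global minimal model `W` (integral `b`'s), then `4θ ∈ 𝓞_F` and it is
a root of the monic `g = Y³ + b₂Y² + 8b₄Y + 16b₆ ∈ ℤ[Y]` (`g(4θ) = 16 · cubic(θ)`).
[cite: SilvermanAEC2009, III.1 (the quantities b₂, b₄, b₆) and VIII.8 (global minimal model)] -/
theorem exists_integral_root_twoDivisionMonic (W : WeierstrassCurve ℚ) [W.IsGloballyMinimal]
    {F : Type*} [Field F] [NumberField F] {θ : F}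
    (hθ : aeval θ W.twoTorsionPolynomial.toPoly = 0) :
    ∃ η : 𝓞 F, (η : F) = 4 * θ ∧
      aeval η (Cubic.toPoly ⟨1, (integralModelInt W).b₂, 8 * (integralModelInt W).b₄,
        16 * (integralModelInt W).b₆⟩) = 0 := by
  set M : WeierstrassCurve ℤ := integralModelInt W with hM
  set g : ℤ[X] := Cubic.toPoly ⟨1, M.b₂, 8 * M.b₄, 16 * M.b₆⟩ with hg
  -- the `b`'s of `W` are the integers `b`'s of `M`
  have hb₂ : W.b₂ = (M.b₂ : ℚ) := by
    conv_lhs => rw [← map_integralModelInt W]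
    rw [map_b₂, eq_intCast]
  have hb₄ : W.b₄ = (M.b₄ : ℚ) := by
    conv_lhs => rw [← map_integralModelInt W]
    rw [map_b₄, eq_intCast]
  have hb₆ : W.b₆ = (M.b₆ : ℚ) := by
    conv_lhs => rw [← map_integralModelInt W]
    rw [map_b₆, eq_intCast]
  -- the cubic relation for `θ` in `F`
  have hcub : (4 : F) * θ ^ 3 + (M.b₂ : F) * θ ^ 2 + 2 * (M.b₄ : F) * θ + (M.b₆ : F) = 0 := by
    have h := hθ
    simp only [twoTorsionPolynomial, Cubic.toPoly, hb₂, hb₄, hb₆, map_add, map_mul, aeval_C,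
      aeval_X_pow, aeval_X, eq_ratCast] at h
    push_cast at h
    linear_combination h
  -- `g(4θ) = 16 · cubic(θ) = 0`
  have hroot : eval₂ (algebraMap ℤ F) (4 * θ) g = 0 := by
    rw [hg, Cubic.toPoly]
    simp only [eval₂_add, eval₂_mul, eval₂_C, eval₂_X_pow, eval₂_X]
    simp only [eq_intCast, Int.cast_one, Int.cast_mul, Int.cast_ofNat, one_mul]
    linear_combination (16 : F) * hcub
  have hmonic : g.Monic := Cubic.monic_of_a_eq_one rfl
  have hint : _root_.IsIntegral ℤ (4 * θ : F) := ⟨g, hmonic, hroot⟩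
  have hmem : (4 * θ : F) ∈ integralClosure ℤ F := hint
  refine ⟨⟨4 * θ, hmem⟩, rfl, ?_⟩
  apply RingOfIntegers.coe_injective
  rw [← aeval_algebraMap_apply, map_zero, RingOfIntegers.map_mk, aeval_def]
  exact hroot

/-! ## §4 THE DICTIONARY: `a_q` odd at a good odd prime ⟹ `q` inert in the cubic `2`-division field -/

/-- **INGREDIENTS F9 (open half), PROVED: `a_q(E)` odd ⟹ `q` inert in `F`.** For a globally
minimal `W / ℚ`, a cubic `2`-division number field `F` of `W` (`Zhai2016.IsTwoDivisionField W F`: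
`[F : ℚ] = 3`, `F ∋ θ` a root of `4X³ + b₂X² + 2b₄X + b₆`), and an odd prime `q` of good reduction
(`q ∤ Δ_min(W)`) with `a_q(W) = q + 1 − #Ẽ(𝔽_q)` odd: `q𝓞_F` is a prime ideal, i.e. `q` is inert
in `F` (`Zhai2016.IsInertIn F q`) — «`Frob_q` acts on `E[2] ∖ {0}` as a `3`-cycle». Assembly of §1–§3.
[cite: Zhai2016, §1 (arXiv:1409.0231 chunk p0002 L18: "inert in the field F")]
[cite: KrizLi2019, Def. 4.1 with p0014 L57–L58 (a_ℓ odd ⟺ Frob_ℓ of order 3)]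
[cite: SilvermanAEC2009, III.2.3, Exercise 3.7, V.2] -/
theorem isInertIn_of_odd_frobeniusTrace (W : WeierstrassCurve ℚ) [W.IsGloballyMinimal]
    {F : Type} [Field F] [NumberField F] (hF : IsTwoDivisionField W F)
    {q : ℕ} (hq : q.Prime) (hq2 : q ≠ 2) (hgood : ¬ (q : ℤ) ∣ minimalDiscriminantInt W)
    (hodd : Odd (W.frobeniusTrace q)) : IsInertIn F q := by
  obtain ⟨hdeg, θ, hθ⟩ := hF
  obtain ⟨η, -, hη⟩ := exists_integral_root_twoDivisionMonic W hθ
  have hmonic : (Cubic.toPoly ⟨1, (integralModelInt W).b₂, 8 * (integralModelInt W).b₄,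
      16 * (integralModelInt W).b₆⟩).Monic := Cubic.monic_of_a_eq_one rfl
  have hdeg3 : (Cubic.toPoly ⟨1, (integralModelInt W).b₂, 8 * (integralModelInt W).b₄,
      16 * (integralModelInt W).b₆⟩).natDegree = Module.finrank ℚ F := by
    rw [Cubic.natDegree_of_a_ne_zero (one_ne_zero), hdeg]
  unfold IsInertIn
  exact isPrime_span_of_irreducible_map hq hmonic hdeg3
    (irreducible_twoDivisionMonic_map_of_odd_frobeniusTrace W hq hq2 hgood hodd) η hη

/-- **Zhai's binder `hin` from the cell's class condition.** For a globally minimal `W / ℚ`, a cubic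
`2`-division field `F`, and an ODD integer `M` every prime `q` of which is a good prime with `a_q(W)`
odd (`hS`, the `a_q`-odd class condition): every `q ∈ M.natAbs.primeFactors` is `≠ 2` and inert in
`F` — the binder `hin` of `Zhai2016.thm11_ordTwo_LAlg_twist_eq_zero'` / `thm12_…'` verbatim.
[cite: Zhai2016, Thm. 1.1 (hypothesis "q₁, …, q_r … inert in the field F")] -/
theorem forall_isInertIn_of_oddTrace (W : WeierstrassCurve ℚ) [W.IsGloballyMinimal]
    {F : Type} [Field F] [NumberField F] (hF : IsTwoDivisionField W F) {M : ℤ}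
    (hM2 : ¬ (2 : ℤ) ∣ M)
    (hS : ∀ (q : ℕ), q.Prime → (q : ℤ) ∣ M →
      ¬ (q : ℤ) ∣ minimalDiscriminantInt W ∧ Odd (W.frobeniusTrace q)) :
    ∀ q ∈ M.natAbs.primeFactors, q ≠ 2 ∧ IsInertIn F q := by
  intro q hq
  rw [Nat.mem_primeFactors] at hq
  obtain ⟨hqp, hqd, -⟩ := hq
  have hqd' : (q : ℤ) ∣ M := Int.natCast_dvd.mpr hqd
  have hq2 : q ≠ 2 := by
    rintro rfl
    exact hM2 (by exact_mod_cast hqd')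
  exact ⟨hq2, isInertIn_of_odd_frobeniusTrace W hF hqp hq2 (hS q hqp hqd').1 (hS q hqp hqd').2⟩

/-! ## §5 A cubic `2`-division number field exists when `E(ℚ)[2] = 0` -/

/-- **`E(ℚ)[2] = 0` ⟹ a cubic `2`-division field exists.** If `W / ℚ` is elliptic with no rational
point of order `2`, the `2`-division cubic `4X³ + b₂X² + 2b₄X + b₆` has no rational root (a root is
the `x`-coordinate of a `2`-torsion point, `TwoTorsionField.exists_two_nsmul_eq_zero_of_root`), hence
is irreducible over `ℚ`, and `F = ℚ[X]/(cubic)` is a number field of degree `3` containing a root: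
`Zhai2016.IsTwoDivisionField W F` ("the field obtained by adjoining to `ℚ` one fixed root of `F(x)`",
Zhai 2016 §1). Discharges the DATA binder `F` of Zhai's theorems on the `a_q`-odd class.
[cite: Zhai2016, §1 (arXiv:1409.0231 chunk p0002 L18)] [cite: SilvermanAEC2009, III.2.3] -/
theorem exists_isTwoDivisionField (W : WeierstrassCurve ℚ) [W.IsElliptic]
    (hT : ∀ P : W.toAffine.Point, 2 • P = 0 → P = 0) :
    ∃ (F : Type) (_ : Field F) (_ : NumberField F), IsTwoDivisionField W F := by
  set f : ℚ[X] := W.twoTorsionPolynomial.toPoly with hf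
  have ha : W.twoTorsionPolynomial.a = 4 := rfl
  have hdeg : f.natDegree = 3 := Cubic.natDegree_of_a_ne_zero (by rw [ha]; norm_num)
  have hne : f ≠ 0 := Cubic.ne_zero_of_a_ne_zero (by rw [ha]; norm_num)
  -- no rational root
  have hirr : Irreducible f := by
    refine Polynomial.irreducible_of_degree_le_three_of_not_isRoot (by rw [hdeg]; decide)
      fun x hx => ?_
    have hx' : x ∈ W.twoTorsionPolynomial.roots := (mem_roots hne).mpr hx
    rw [Cubic.mem_roots_iff hne] at hx'
    simp only [twoTorsionPolynomial] at hx'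
    obtain ⟨P, hP0, hP2⟩ :=
      exists_ne_zero_two_nsmul_eq_zero_of_cubic_root W (by norm_num : (2 : ℚ) ≠ 0) hx'
    exact hP0 (hT P hP2)
  haveI : Fact (Irreducible f) := ⟨hirr⟩
  haveI : NumberField (AdjoinRoot f) := NumberField.mk
  -- (the `ℚ`-algebra structure on the field `AdjoinRoot f` is unique: `convert` closes the instance
  -- discrepancy `DivisionRing.toRatAlgebra` vs `AdjoinRoot.instAlgebra` by `Subsingleton.elim`)
  refine ⟨AdjoinRoot f, inferInstance, inferInstance, ?_, AdjoinRoot.root f, ?_⟩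
  · have h := (AdjoinRoot.powerBasis hne).finrank
    rw [AdjoinRoot.powerBasis_dim, hdeg] at h
    convert h
  · rw [aeval_def, Subsingleton.elim (algebraMap ℚ (AdjoinRoot f)) (AdjoinRoot.of f)]
    exact AdjoinRoot.eval₂_root f

end Summit.BirchSwinnertonDyer.Uniform.U2

end
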